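import Mathlib
import Summits.Langlands.Langlands.Theses.PhantomRMYoshida
import Summits.Langlands.Langlands.Theorems.PhantomRMYoshidaStableYoshidaCongruenceSector
import Summits.Langlands.Langlands.Theorems.PhantomRMYoshidaStableYoshidaCongruenceBWSector
import Summits.Langlands.Langlands.Theorems.PhantomRMYoshidaStableYoshidaCongruenceModFaltingsResidue
import Summits.Langlands.Langlands.Theorems.PhantomRMYoshidaFaltingsTateModuleQGate
import Literature.NumberTheory.GaloisRepresentations.SerreWeight
import Literature.NumberTheory.GaloisRepresentations.ResidualPair
import Literature.NumberTheory.DiophantineGeometry.AbelianVarietyOrdinaryReduction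
import Literature.AlgebraicGeometry.Motives.FaltingsAbelian
import Literature.AlgebraicGeometry.Motives.FaltingsFinitenessI
import Literature.NumberTheory.DiophantineGeometry.BcgpResiduallyA5bModular
import Summits.Langlands.Langlands.Theorems.PhantomRMYoshidaStableYoshidaCongruenceSemistableGreenberg
import Summits.Langlands.Langlands.Theorems.PhantomRMYoshidaStableYoshidaCongruenceSemistableSector
import HarnessLib

/-!
# Line `semistable-three-adic-anchor` — checked skeleton for the crux
`Summit.Langlands.Langlands.Theses.PhantomRMYoshida.StableYoshidaCongruence` (stmt-Langlands-13640)

Planner crux-plan round 2 (idea card `Ideas/semistable-three-adic-anchor.md`, ideator seat 5; triage r2: pass ×2,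
"file as the corrected child A at p = 3 (second tier A₂ beside the landed BW sector A₁)").

## The idea in one paragraph

The landed Burkhardt–Weddle sector theorem (`…BurkhardtWeddleTwoThreeAnchor.stub_bwSectorModuloFacts`, p117182) closes the
crux, modulo four theorems in print, on the sector `p = 3 ∧ 𝔽₃-rational ∧ PEU RAMIFIÉ at 3 ∧ switchable at 2`.  Its 3-adic
clause is an artefact of citing arXiv:2502.20645 Lemma 9.4.2 as printed ("`ρ̄^∨|G_{ℚ₃}` ordinary AND FINITE FLAT"): the
modularity engine actually invoked, ibid. Thm 8.3.2 (2-adic, residually `A₅(b)`), assumes NOTHING at 3.  The crux's own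
witness hypothesis H5 already forces `σ̄|Γ₃`, `σ̄'|Γ₃` to be ORDINARY-SHAPED (landed `stub_residualLattice` +
`stub_ordinaryFrameFp`), and the only local invariant left — peu/très ramifié — can be absorbed by anchoring the weak
approximation on the rational twisted Burkhardt space `P(ρ̄)` at a SEMISTABLE point of `P(ρ̄)(ℚ₃)` (Tate-uniformised /
Mumford–Faltings–Chai degeneration with ordinary abelian part) instead of a good ordinary one.  The resulting abelian
surface `B/ℚ` is semistable at 3 with ordinary Raynaud abelian part; its 3-adic Tate module is still ORDINARY-FILTERED
(`W = V₃(G⁰) ⊂ V₃(B)`, `G⁰` the multiplicative part of the Raynaud extension: inertia `= χ` on `W`, trivial on `V/W` by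
the 1-motive / `N(V) ⊂ V(T)` argument), which is all that the landed Greenberg dictionary consumes.  So the new sector is
`SemistableSector := p = 3 ∧ 𝔽₃-rational ∧ switchable at 2` (BW minus `IsPeuRamifie`), containing the route's motivating
phantom-RM surfaces with multiplicative reduction at 3.

## Shape (data flow of `StableYoshidaCongruence_of`; everything but the three `stub_*` is sorry-free)

`crux_iff` (LTWS, `Iff.rfl`) ↦ `CruxAt p k red σ σ'`; classical split on `SemistableSector p k σ σ'`:
* IN the sector (`p = 3`): `semistableSwitchable_of_sector` (= landed Stubs 1–5 of the BW line with the peu-ramifié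
  transfer dropped) ↦ `SemistableSwitchable 3 k σ σ'` (symplectic `𝔽₃`-model, ordinary-SHAPED frame at 3, switchable
  at 2); `stub_sectorFacts` (the four printed facts, byte-identical to BW's) + `stub_tresRamifieSwitch` (THE LEVER) ↦
  `semistableSwitch_of_facts` ↦ `SemistableSwitch` (case split peu/très: the peu case IS the Literature fact
  `bcgp_switch_exists_modular_abelianSurface` + Serre–Tate); `greenberg_of_ordinaryFiltration` (the landed Greenberg
  proof re-keyed to the filtration) + `cruxAt_of_semistableSwitchable` (the SECTOR THEOREM: framed `H¹`, Weil, Faltings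
  via Finiteness I, residual pair, distinguishedness transfer) ↦ `CruxAt`.
* OFF the sector: `stub_offSemistableSector` (the honest open remainder, strictly smaller than BW's `stub_offSector`).

## Registered stubs (3)

1. `stub_tresRamifieSwitch : TresRamifieSwitch` — THE LEVER and hardest stub of the line (XL; NOT in print as a
   statement: the semistable sibling of arXiv:2502.20645 Lemma 9.4.2 for Yoshida-type `ρ̄` with a TRÈS RAMIFIÉ block at
   `3`, output keyed to the ordinary FILTRATION of `V₃(B)` instead of good reduction).
2. `stub_sectorFacts : FaltingsFinitenessI ∧ ordinaryReduction_tateModule_filtration ∧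
   bcgp_switch_exists_modular_abelianSurface ∧ weilPairing_rationalTateModule` — four theorems in print, ONE obligation,
   byte-identical to the registered `…BurkhardtWeddleTwoThreeAnchor.stub_sectorFacts` (the first conjunct is the
   route's own gate item stmt-Langlands-15084).
3. `stub_offSemistableSector` — the crux off the enlarged sector (open remainder; not claimed by the line).
So: the crux is CLOSED IN LEAN on `{p = 3} ∩ {𝔽₃-rational} ∩ {unramified at 2, Frob₂ ∉ 4C ∪ 12C}` modulo four
theorems in print and ONE unprinted statement (`TresRamifieSwitch`), with NO 3-adic hypothesis on the pair.

## Disproof used (Cruxes/StableYoshidaCongruence/Disproof.lean, cdisprove cycle 3, read in full 2026-08-16)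

* §2 `exists_cuspForm_of_not_crux`: no `_false_without_H` theorem exists for this crux — nothing of that form to honour;
  correspondingly `AutGL4` is reached only modulo the named automorphic output of Stub 1 (as for every line).
* §4 `loadBearing`: H5 (`∃ ρ, Sh ρ`) is consumed exactly for what §4 says it certifies — the ordinary `p`-distinguished
  SHAPE of the pair at 3 (`semistableSwitchable_of_sector` via landed `stub_residualLattice`/`stub_ordinaryFrameFp`) and,
  inside Stub 3, residual distinguishedness of `ρ₀` (landed `stub_charpolyCongruence` + `stub_distinguishedTransferLocal`);
  the peu/très dichotomy is the part of H5's local content that BW threw away and this line keeps.  H1 (`AutGL2`) is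
  decoration (§3.5) and is threaded only to the remainder; H2/H3/H4 feed the landed model/symplectic-form stubs.
* §3.2 Irr′-trap avoided: no stub takes an irreducible witness; reducible witnesses (e.g. `ρ_f^∨ ⊕ ρ_g^∨`, `f` 3-new of
  weight 2 — a très ramifié pair) are served.  §3.3: on the sector the line proves `IrrLiftAt` and automorphy together.
* §5 R2: this is R2 with its 3-adic side condition removed; R4/D-residue/§6 (expected dimension −1, rigid pair) are
  exactly `stub_offSemistableSector`, left whole and unclaimed.
* No `Negative/` lemma has landed for this crux (nothing to import); negatives index (`ledger negatives --problem
  Langlands`): 1 unrelated entry (K3 Kuga–Satake, stmt-Langlands-3797); no stub restates a refuted statement.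
-/

set_option linter.dupNamespace false
set_option linter.unusedVariables false

noncomputable section

open CategoryTheory IsDedekindDomain Polynomial
open scoped NumberField commutatorElement Matrix
open Literature.NumberTheory.GaloisRepresentations Literature.NumberTheory.Automorphic
open Literature.AlgebraicGeometry.Motives (AbelianVariety)
open Literature.NumberTheory.DiophantineGeometry (weilPairing_rationalTateModule
  ordinaryReduction_tateModule_filtration bcgp_switch_exists_modular_abelianSurface
  bcgp_residuallyA5b_modular_abelianSurface s5bMatrix)
open Summit.Langlands.Langlands.Theses.PhantomRMYoshida
open Summit.Langlands.Langlands.Theorems.PhantomRMYoshida (faltings_tate_bijective_of_finitenessI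
  isSemisimpleRepresentation_rationalTateRep_of_finitenessI)
open Summit.Langlands.Langlands.Cruxes.StableYoshidaCongruence.LevelThreeWeierstrassSwitch
open Summit.Langlands.Langlands.Cruxes.StableYoshidaCongruence.BurkhardtWeddleTwoThreeAnchor

namespace Summit.Langlands.Langlands.Cruxes.StableYoshidaCongruence.SemistableThreeAdicAnchor

/-! ## Vocabulary — everything but the five names below is imported from the landed LTWS / BW files
(`Sh`, `AutGL2`, `AutGL4`, `DetCond`, `NonConj`, `CruxAt`, `crux_iff`, `epsBar`, `toK`, `IsModelOf`, `IsOrdinaryFlatAt`,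
`IsSwitchableAtTwo`, `Switchable`, `TateFrame`, `EndTrivial`, `stub_*`). -/

section Vocabulary

variable (p : ℕ) [Fact p.Prime] (k : Type) [Field k] [CharP k p] [TopologicalSpace k] [DiscreteTopology k]

/- `IsOrdinaryShapedAt` is imported from the landed `Theorems/…SemistableSector.lean` (p129342). -/

/-- **`SemistableSwitchable p k σ σ'`** — the input of the semistable switch: `σ ⊕ σ'` admits an `𝔽_p`-model
`ρb : Γ_ℚ → GL₄(𝔽_p)` which is symplectic with multiplier `ε̄⁻¹`, ORDINARY-SHAPED at the place(s) above `p`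
(`IsOrdinaryShapedAt`, no peu-ramifié clause) and unramified at `2` off `4C/12C` (`IsSwitchableAtTwo`).  The landed
`Switchable` (LTWS) is the sub-case "and peu ramifié at `p`" (`semistableSwitchable_of_switchable`). -/
def SemistableSwitchable (σ σ' : FramedGaloisRep ℚ k 2) : Prop :=
  ∃ ρb : FramedGaloisRep ℚ (ZMod p) 4,
    ρb.IsSymplecticWithMultiplierFun (fun g => (((epsBar p g)⁻¹ : (ZMod p)ˣ) : ZMod p)) ∧
    IsModelOf ρb σ σ' ∧
    (∀ v : HeightOneSpectrum (𝓞 ℚ), ((p : ℕ) : 𝓞 ℚ) ∈ v.asIdeal → IsOrdinaryShapedAt p v ρb) ∧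
    (∀ v : HeightOneSpectrum (𝓞 ℚ), ((2 : ℕ) : 𝓞 ℚ) ∈ v.asIdeal → IsSwitchableAtTwo p v ρb)

/-- **The semistable sector** at the data `(p, k, σ, σ')`: `p = 3`; the pair is `𝔽_p`-RATIONAL (every
`charpoly σ(g) · charpoly σ'(g)` comes from `𝔽_p[X]`: both constituents `𝔽₃`-rational, or the phantom-RM pair
`σ' ≅ σ^(3)` over `𝔽₉`); and at `v ∣ 2` both are unramified with `P₁ P₂ ≠ (X² ± X + 2)²` (⇔ `Frob₂ ∉ 4C ∪ 12C`,
arXiv:2502.20645 Thm 9.5.2 (2)).  VERBATIM the landed Burkhardt–Weddle sector (`stub_bwSectorModuloFacts`, p117182) with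
its 3-adic conjunct `IsPeuRamifie (σ.toLocal v) ∧ IsPeuRamifie (σ'.toLocal v)` DELETED (`semistableSector_of_bwSector`):
nothing at all is assumed at `3` — the ordinary shape there is DERIVED from H5 (`semistableSwitchable_of_sector`). -/
def SemistableSector (σ σ' : FramedGaloisRep ℚ k 2) : Prop :=
  p = 3 ∧
  (∀ g : Field.absoluteGaloisGroup ℚ, ∃ Q : Polynomial (ZMod p),
      Q.map (ZMod.castHom (dvd_refl p) k) = FramedRep.charpoly σ g * FramedRep.charpoly σ' g) ∧
  (∀ v : HeightOneSpectrum (𝓞 ℚ), ((2 : ℕ) : 𝓞 ℚ) ∈ v.asIdeal →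
      σ.IsUnramifiedAt v ∧ σ'.IsUnramifiedAt v ∧
      ∃ P₁ P₂ : Polynomial k, σ.HasFrobCharpolyAt v P₁ ∧ σ'.HasFrobCharpolyAt v P₂ ∧
        P₁ * P₂ ≠ (X ^ 2 + X + C 2) ^ 2 ∧ P₁ * P₂ ≠ (X ^ 2 - X + C 2) ^ 2)

/- `IsOrdinaryFilteredAt` is imported from the landed `Theorems/…SemistableGreenberg.lean` (p128873). -/

end Vocabulary

/-! ## The two new named statements of the line -/

section Statements

/-- **`SemistableSwitch` — SEMISTABLE SWITCHING for Yoshida-type `ρ̄` (NOT in print as a statement).**  The semistable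
sibling of `Literature.NumberTheory.DiophantineGeometry.bcgp_switch_exists_modular_abelianSurface` (arXiv:2502.20645
Lemma 9.4.2 + Thm 8.3.2 + transfer, combined as in the proof of Thm 9.5.2), RESTRICTED to the inputs this line needs and
for which the local analysis at `3` was carried out (triage r2-2 (a)–(c)): `ρ̄ : Γ_ℚ → GSp₄(𝔽₃)` symplectic-`ε̄⁻¹` which is
an `𝔽₃`-MODEL OF A PAIR (`IsModelOf ρ̄ σ σ'`, `σ, σ' : Γ_ℚ → GL₂(k)` with `det σ = det σ' = ε̄⁻¹`, `DetCond`), ORDINARY-SHAPED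
at `3` (`IsOrdinaryShapedAt`: unramified rank-2 sub, `ε̄⁻¹ ⊗ unr` quotient, extension classes peu OR très ramifiées —
the `IsPeuRamifie` conjunct of the printed fact is DROPPED), unramified at `2` with `charpoly ρ̄(Frob₂) ≠ (X² ± X + 2)²`.
OUTPUT as in the printed fact but with "good ordinary reduction at `3`" REPLACED by "`V₃(B)` ordinary-filtered at `3`"
(`IsOrdinaryFilteredAt`): an abelian surface `B/ℚ` with `End_ℚ(B) = ℤ·id`, whose framed `H¹ = (V₃ B)^∨ ⊗ ℚ̄₃` has
`ℤ₃`-integral characteristic polynomials reducing to those of `ρ̄`, and which is MODULAR (`AutGL4`: L-algebraic cuspidal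
`π` on `GL₄(𝔸_ℚ)`, a.e. Satake–Frobenius matching).  `semistableSwitch_of_facts`: the peu-ramifié case IS the printed fact
+ Serre–Tate; the très-ramifié case is `TresRamifieSwitch` (Stub 1).
Intended proof of the très case (paper; (a), (c)–(e) are BCGP's own arrows, (b)+(f) are the new local pieces):
(a) `P(ρ̄)` — p.p. abelian surfaces `A` with a symplectic `A[3] ≅ ρ̄^∨` and an odd theta characteristic, equivalently
(ibid. Def. 9.2.1 ff., p.128) with `im ρ̄_{A,2}` conjugate into `S₅(b)` — is smooth and RATIONAL over `ℚ` for every `ρ̄` of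
similitude `ε̄⁻¹` [BCGP2021 §10.2].  (b) LOCAL ANCHOR AT 3: over `𝔽̄₃`, `ρ̄|Γ₃ ≅ σ|Γ₃ ⊕ σ'|Γ₃` (model of a pair), each block
ordinary-shaped with `det = ε̄⁻¹`; a TRÈS RAMIFIÉ block `(ε̄⁻¹b, ∗; 0, a)^{∨-convention}` has `a = b` (the
Frobenius-invariant Kummer classes over `ℚ₃^{nr}` of a non-trivial unramified twist are unit classes) hence `a² = 1`,
so it is `E_q[3] ⊗ a` with `a ∈ {1, ω_nr}`: the 3-torsion of a Tate curve `E_q/ℚ₃` or of its unramified quadratic twist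
(non-split multiplicative reduction) — `E_q[3]` has Kummer class `q mod (ℚ₃^×)³`, so every très ramifié class is hit, and
`q` may even be taken a SQUARE in its cube class (adjust `v(q)` by `3v(c)`, the unit by `c³ ≡ c mod squares`), making all
of `E_q[2] = {±1, ±√q}` rational as in BCGP's own 2-adic construction; a peu-ramifié companion
block is `E₁[3]` for a good ordinary `E₁/ℚ₃` (Serre–Tate lift, as in ibid. Lemma 9.3.6); the anchor is `B₀ = E₁ × E_q`
(resp. `E_q × E_{q'}`) with the product principal polarisation — semistable with ordinary abelian part, and a point of
`P(ρ̄)(ℚ₃)` because `−1 ∈ E_q[2](ℚ₃)` gives a rational odd theta characteristic `𝒪_{E₁} ⊠ 𝒪(−1 − O)` (exactly the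
device of ibid. §9.2, Lemma "firstconstruction", p.129 of the held text: `X × Y` with `X` a Tate curve, `q` a sixth power); the two isometry classes of
symplectic forms are both realised (`q' ∈ q·(ℚ₃^×)³` vs `q²·(ℚ₃^×)³`, triage r2-2).  (c) OPENNESS at `B₀` (the step ibid.
proof of Lemma 9.4.2 runs at `2` for "good ordinary OR SEMISTABLE ordinary" anchors): every `B ∈ P(ρ̄)(ℚ₃)` 3-adically
close to `B₀` has `B[N] ≅ B₀[N]` for `N = 5·7` (Kisin's local constancy), hence is semistable at `3`
(Silverberg–Zarhin: semistability is read off `B[N]`, `N ≥ 5`), with toric rank `≥ 1` and abelian part ordinary or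
zero (compare inertia on `B[3] ≅ ρ̄^∨`: characters `{1, 1, ε̄, ε̄}`, no level-2 fundamental character), so `V₃(B)` is
ordinary-filtered by (f).  (d) Weak approximation on the rational `P(ρ̄)` off thin sets with the local conditions at
`2, 3, ∞` (ibid. Lemma 9.4.1) + Hilbert irreducibility ⇒ `B/ℚ` p.p. with `ρ̄_{B,3} ≅ ρ̄`, `A₅(b) ⊆ im ρ̄_{B,2} ⊆ S₅(b)`,
good-or-semistable ordinary and 2-distinguished at `2`, `End(B_ℚ̄) = ℤ`.  (e) ibid. Thm 8.3.2 (= Thm 386, p.124: its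
hypotheses are at `2` and `∞` ONLY; the proof splits the places of bad reduction in `E`, so multiplicative reduction at
`3` is allowed) ⇒ `B` modular, `ρ_{π,p} ≅ ρ_{B,p}` for all `p`; general type (`End = ℤ`) ⇒ cuspidal transfer to `GL₄/ℚ`
(Arthur / Gee–Taïbi), L-normalised as in the printed fact.  (f) `V₃(B)` ordinary-filtered: docstring of
`IsOrdinaryFilteredAt`.  The UNRESTRICTED statement (all symplectic ordinary-shaped `ρ̄`, mixed local classes) is expected
too (toric-rank-`t` Mumford–Faltings–Chai degenerations as anchors) but is not needed here and not claimed.  Size XL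
(L for (b)+(c)+(f) as Lean-free lemmas; the rest is the XL dictionary shared with the printed fact).  Cheapest
falsifier: the finite enumeration behind (b) — ordinary-shaped symplectic `𝔽₃[Γ_{ℚ₃}]`-types that are sums of two
`det = ε̄⁻¹` blocks with a très ramifié block, against products of Tate curves / ordinary curves with both form classes.
[cite: BoxerCalegariGeePilloni2025, Lemma 9.4.2, Lemma 9.4.1, Cor. 9.3.5, Lemma 9.3.6, §9.2 (Def. of P(ρ̄); the X × Y construction), Thm. 8.3.2, Thm. 9.5.2 and its proof (arXiv:2502.20645)]
[cite: BoxerEtAl2021, §10.2 (P(ρ̄) rational)] [cite: Serre1987, §2.4, §2.8 (peu/très ramifié)]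
[cite: Kisin1999LocalConstancy, Thm. (local constancy of B[N] in p-adic families)] [cite: SilverbergZarhin1995, §6 (semistable reduction read off B[N], N ≥ 5)]
[cite: Raynaud1994UnMotifs, §3–§4] [cite: FaltingsChai1990, Ch. II–III (degenerations; Raynaud extension)] -/
def SemistableSwitch : Prop :=
  ∀ (k : Type) [Field k] [CharP k 3] [IsAlgClosed k] [TopologicalSpace k] [DiscreteTopology k]
    (σ σ' : FramedGaloisRep ℚ k 2) (ρb : FramedGaloisRep ℚ (ZMod 3) 4),
    IsModelOf ρb σ σ' → DetCond 3 σ σ' →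
    ρb.IsSymplecticWithMultiplierFun (fun g => (((epsBar 3 g)⁻¹ : (ZMod 3)ˣ) : ZMod 3)) →
    (∀ v : HeightOneSpectrum (𝓞 ℚ), ((3 : ℕ) : 𝓞 ℚ) ∈ v.asIdeal → IsOrdinaryShapedAt 3 v ρb) →
    (∀ v : HeightOneSpectrum (𝓞 ℚ), ((2 : ℕ) : 𝓞 ℚ) ∈ v.asIdeal → IsSwitchableAtTwo 3 v ρb) →
    ∃ B : AbelianVariety ℚ,
      B.dim = 2 ∧
      (∀ v : HeightOneSpectrum (𝓞 ℚ), ((3 : ℕ) : 𝓞 ℚ) ∈ v.asIdeal → IsOrdinaryFilteredAt 3 B v) ∧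
      EndTrivial B ∧
      ∀ (b : Module.Basis (Fin 4) ℚ_[3] (B.rationalTateModule 3)) (r : FramedGaloisRep ℚ (PadicAlgCl 3) 4),
        TateFrame 3 B b r →
        (∀ g : Field.absoluteGaloisGroup ℚ, ∃ P : Polynomial ℤ_[3],
            P.map (algebraMap ℤ_[3] (PadicAlgCl 3)) = FramedRep.charpoly r g ∧
            P.map (PadicInt.toZMod (p := 3)) = FramedRep.charpoly ρb g) ∧
        ∀ (hcpt : isCompact_glFiniteIntegralLevel 4 ℚ) (ι : PadicAlgCl 3 ≃+* ℂ), AutGL4 3 hcpt ι r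

/-- **`TresRamifieSwitch` — the NEW half of `SemistableSwitch`: Yoshida-type inputs that are NOT peu ramifié at `3`.**
The same statement as `SemistableSwitch` for the `ρ̄` whose restriction to `Γ_{ℚ₃}` is NOT peu ramifiée (some block of
the ordinary shape has a très ramifié = non-unit Kummer extension class; Serre 1987 §2.4), i.e. exactly the inputs the
printed Lemma 9.4.2 ("finite flat") excludes — among them the route's motivating phantom-RM surfaces with multiplicative
reduction at `3`, and every eligible pair one of whose constituents is `ρ̄_{E,3}^∨` for an elliptic curve `E/ℚ` with
multiplicative reduction at `3` and `3 ∤ v₃(Δ_E)` (Tate: `E[3]|Γ₃` très ramifié iff `3 ∤ v₃(q) = v₃(Δ_E)`).  `semistableSwitch_of_facts`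
(sorry-free) shows `SemistableSwitch ⟸ printed switch + Serre–Tate + TresRamifieSwitch`, so THIS is the line's one
unprinted obligation.  Its anchors at `3` are genuinely semistable (a très ramifié `B₀[3]` is not finite flat, so `B₀`
has toric rank `≥ 1`): products with a Tate-curve factor, (b) of `SemistableSwitch`.  Size XL.
[cite: BoxerCalegariGeePilloni2025, Lemma 9.4.2, Lemma 9.4.1, §9.2, Thm. 8.3.2, Thm. 9.5.2 (arXiv:2502.20645)]
[cite: Serre1987, §2.4, §2.8] [cite: Kisin1999LocalConstancy] [cite: SilverbergZarhin1995, §6] -/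
def TresRamifieSwitch : Prop :=
  ∀ (k : Type) [Field k] [CharP k 3] [IsAlgClosed k] [TopologicalSpace k] [DiscreteTopology k]
    (σ σ' : FramedGaloisRep ℚ k 2) (ρb : FramedGaloisRep ℚ (ZMod 3) 4),
    IsModelOf ρb σ σ' → DetCond 3 σ σ' →
    ρb.IsSymplecticWithMultiplierFun (fun g => (((epsBar 3 g)⁻¹ : (ZMod 3)ˣ) : ZMod 3)) →
    (∀ v : HeightOneSpectrum (𝓞 ℚ), ((3 : ℕ) : 𝓞 ℚ) ∈ v.asIdeal → IsOrdinaryShapedAt 3 v ρb) →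
    ¬ (∀ v : HeightOneSpectrum (𝓞 ℚ), ((3 : ℕ) : 𝓞 ℚ) ∈ v.asIdeal → ModPGaloisRep.IsPeuRamifie (ρb.toLocal v)) →
    (∀ v : HeightOneSpectrum (𝓞 ℚ), ((2 : ℕ) : 𝓞 ℚ) ∈ v.asIdeal → IsSwitchableAtTwo 3 v ρb) →
    ∃ B : AbelianVariety ℚ,
      B.dim = 2 ∧
      (∀ v : HeightOneSpectrum (𝓞 ℚ), ((3 : ℕ) : 𝓞 ℚ) ∈ v.asIdeal → IsOrdinaryFilteredAt 3 B v) ∧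
      EndTrivial B ∧
      ∀ (b : Module.Basis (Fin 4) ℚ_[3] (B.rationalTateModule 3)) (r : FramedGaloisRep ℚ (PadicAlgCl 3) 4),
        TateFrame 3 B b r →
        (∀ g : Field.absoluteGaloisGroup ℚ, ∃ P : Polynomial ℤ_[3],
            P.map (algebraMap ℤ_[3] (PadicAlgCl 3)) = FramedRep.charpoly r g ∧
            P.map (PadicInt.toZMod (p := 3)) = FramedRep.charpoly ρb g) ∧
        ∀ (hcpt : isCompact_glFiniteIntegralLevel 4 ℚ) (ι : PadicAlgCl 3 ≃+* ℂ), AutGL4 3 hcpt ι r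

/-- **`GreenbergOfOrdinaryFiltration` — the Greenberg dictionary from the FILTRATION (provable now).**  For an abelian
surface `B/ℚ`, a `ℚ_p`-basis `b` of `V_p B` and its framed `H¹` `ρ₀` (`TateFrame`: `ρ₀(g) = [g⁻¹]_bᵀ ⊗ ℚ̄_p`), if
`V_p(B)` is ordinary-filtered at `v ∣ p` (`IsOrdinaryFilteredAt`) then `ρ₀` is Greenberg-ordinary of shape `(0,0,1,1)`
at `v` (tree `IsGreenbergOrdinaryOfShapeAt`: unramified rank-2 sub `W^⊥`, quotient `W^∨ = χ⁻¹ ⊗ unr`, the two blocks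
triangularised over `ℚ̄_p` as commuting families, inertia scalar inside each block).  This is EXACTLY the landed proof of
`…LevelThreeWeierstrassSwitch.stub_tateModuleGreenberg` (Theorems/…TateModuleGreenberg.lean) from its second line on: that
proof's first line obtains the filtration from the Serre–Tate fact + good ordinary reduction, and never uses the reduction
again.  Size S/M (copy ~180 lines, replace the `obtain … := hST B v p hv hord` by the hypothesis).
[cite: Greenberg1991, §2] [cite: BoxerEtAl2021, §7.3 (p-distinguished weight-2 ordinary)] -/
def GreenbergOfOrdinaryFiltration : Prop :=
  ∀ (p : ℕ) [Fact p.Prime] (B : AbelianVariety ℚ)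
    (b : Module.Basis (Fin 4) ℚ_[p] (B.rationalTateModule p)) (ρ₀ : FramedGaloisRep ℚ (PadicAlgCl p) 4),
    TateFrame p B b ρ₀ → B.dim = 2 →
    ∀ v : HeightOneSpectrum (𝓞 ℚ), ((p : ℕ) : 𝓞 ℚ) ∈ v.asIdeal → IsOrdinaryFilteredAt p B v →
      ρ₀.IsGreenbergOrdinaryOfShapeAt v ![0, 0, 1, 1]

end Statements

/-! ## Sanity containments (sorry-free): the new predicates GENERALISE the landed ones exactly as claimed -/

section Containments

variable {p : ℕ} [Fact p.Prime] {k : Type} [Field k] [CharP k p] [TopologicalSpace k] [DiscreteTopology k]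

/-- Ordinary-FLAT (landed LTWS) ⇒ ordinary-SHAPED: drop the peu-ramifié conjunct. -/
theorem isOrdinaryShapedAt_of_isOrdinaryFlatAt {v : HeightOneSpectrum (𝓞 ℚ)} {ρb : FramedGaloisRep ℚ (ZMod p) 4}
    (h : IsOrdinaryFlatAt p v ρb) : IsOrdinaryShapedAt p v ρb :=
  h.2

omit [DiscreteTopology k] in
/-- The landed `Switchable` (BCGP Lemma 9.4.2's printed hypotheses) is a sub-case of `SemistableSwitchable`. -/
theorem semistableSwitchable_of_switchable {σ σ' : FramedGaloisRep ℚ k 2} (h : Switchable p k σ σ') :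
    SemistableSwitchable p k σ σ' := by
  obtain ⟨ρb, hsymp, hmodel, hord, htwo⟩ := h
  exact ⟨ρb, hsymp, hmodel, fun v hv => isOrdinaryShapedAt_of_isOrdinaryFlatAt (hord v hv), htwo⟩

omit [DiscreteTopology k] in
/-- The landed Burkhardt–Weddle sector (inlined exactly as in `stub_bwSectorModuloFacts`, p117182) is contained in the
semistable sector: delete the peu-ramifié clause.  So `stub_offSemistableSector` below is STRICTLY WEAKER than BW's
`stub_offSector`, and the new sector contains the très ramifié pairs (e.g. phantom-RM surfaces multiplicative at 3). -/
theorem semistableSector_of_bwSector {σ σ' : FramedGaloisRep ℚ k 2}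
    (h : p = 3 ∧
      (∀ g : Field.absoluteGaloisGroup ℚ, ∃ Q : Polynomial (ZMod p),
        Q.map (ZMod.castHom (dvd_refl p) k) = FramedRep.charpoly σ g * FramedRep.charpoly σ' g) ∧
      (∀ v : HeightOneSpectrum (𝓞 ℚ), ((p : ℕ) : 𝓞 ℚ) ∈ v.asIdeal →
        ModPGaloisRep.IsPeuRamifie (σ.toLocal v) ∧ ModPGaloisRep.IsPeuRamifie (σ'.toLocal v)) ∧
      (∀ v : HeightOneSpectrum (𝓞 ℚ), ((2 : ℕ) : 𝓞 ℚ) ∈ v.asIdeal →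
        σ.IsUnramifiedAt v ∧ σ'.IsUnramifiedAt v ∧
        ∃ P₁ P₂ : Polynomial k, σ.HasFrobCharpolyAt v P₁ ∧ σ'.HasFrobCharpolyAt v P₂ ∧
          P₁ * P₂ ≠ (X ^ 2 + X + C 2) ^ 2 ∧ P₁ * P₂ ≠ (X ^ 2 - X + C 2) ^ 2)) :
    SemistableSector p k σ σ' :=
  ⟨h.1, h.2.1, h.2.2.2⟩

/-- The new output format GENERALISES the printed one: granted the Serre–Tate fact, good ordinary reduction at `v ∣ p`
gives an ordinary-filtered Tate module (the filtration predicate is that fact's conclusion verbatim at `K = ℚ`).  Hence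
`SemistableSwitch` restricted to peu-ramifié inputs is implied by the printed switch + Serre–Tate. -/
theorem isOrdinaryFilteredAt_of_hasGoodOrdinaryReductionAt (hST : ordinaryReduction_tateModule_filtration)
    (B : AbelianVariety ℚ) (v : HeightOneSpectrum (𝓞 ℚ)) (hv : ((p : ℕ) : 𝓞 ℚ) ∈ v.asIdeal)
    (hord : B.HasGoodOrdinaryReductionAt v) : IsOrdinaryFilteredAt p B v :=
  hST B v p hv hord

end Containments

/-! ## The sector's input is DERIVED from the crux's hypotheses (sorry-free, from the landed BW Stubs 1–5) -/

/-- **The semistable sector delivers `SemistableSwitchable`** (sorry-free; the landed `switchable_of_bwSector` with the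
peu-ramifié transfer dropped): given the crux's hypotheses H2–H5 at data in the sector, `σ ⊕ σ'` has a symplectic-`ε̄⁻¹`
`GSp₄(𝔽_p)`-model (`stub_modelFp`, `stub_symplecticFormFp`), ORDINARY-SHAPED at `p` by H5 (`stub_residualLattice` +
`stub_ordinaryFrameFp` — Disproof §4 "H5 certifies the ordinary p-distinguished pair", forward direction) and switchable
at `2` (`stub_localConditionsTransfer`, second half).  Nothing 3-adic is assumed. -/
theorem semistableSwitchable_of_sector (p : ℕ) [Fact p.Prime] (hp : p ≠ 2) (k : Type) [Field k] [CharP k p]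
    [IsAlgClosed k] [TopologicalSpace k] [DiscreteTopology k] (red : Valued.integer (PadicAlgCl p) →+* k)
    (σ σ' : FramedGaloisRep ℚ k 2)
    (hrat : ∀ g : Field.absoluteGaloisGroup ℚ, ∃ Q : Polynomial (ZMod p),
      Q.map (ZMod.castHom (dvd_refl p) k) = FramedRep.charpoly σ g * FramedRep.charpoly σ' g)
    (htwo : ∀ v : HeightOneSpectrum (𝓞 ℚ), ((2 : ℕ) : 𝓞 ℚ) ∈ v.asIdeal →
      σ.IsUnramifiedAt v ∧ σ'.IsUnramifiedAt v ∧
      ∃ P₁ P₂ : Polynomial k, σ.HasFrobCharpolyAt v P₁ ∧ σ'.HasFrobCharpolyAt v P₂ ∧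
        P₁ * P₂ ≠ (X ^ 2 + X + C 2) ^ 2 ∧ P₁ * P₂ ≠ (X ^ 2 - X + C 2) ^ 2)
    (hirr : σ.toGaloisRep.IsIrreducible) (hirr' : σ'.toGaloisRep.IsIrreducible) (hdet : DetCond p σ σ')
    (hnc : NonConj σ σ') (hw : ∃ ρ : FramedGaloisRep ℚ (PadicAlgCl p) 4, Sh red σ σ' ρ) :
    SemistableSwitchable p k σ σ' := by
  obtain ⟨ρw, -, hloc, hpair⟩ := hw
  obtain ⟨ρb, hmodel⟩ := stub_modelFp p k σ σ' hirr hirr' hrat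
  have hsymp := stub_symplecticFormFp p hp k σ σ' ρb hirr hirr' hdet hnc hmodel
  obtain ⟨-, htwoT⟩ := stub_localConditionsTransfer p k σ σ' ρb hmodel
  refine ⟨ρb, hsymp, hmodel, fun v hv => ?_, fun v hv => ?_⟩
  · obtain ⟨M, hM1, hM2, hM3, -⟩ :=
      stub_residualLattice p hp k red σ σ' ρw v hv (hloc v hv).1 (hloc v hv).2 hpair
    exact stub_ordinaryFrameFp p hp k σ σ' ρb M v hv hirr hirr' hdet hmodel hM1 hM2 hM3
  · obtain ⟨hσ, hσ', hP⟩ := htwo v hv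
    exact htwoT v hσ hσ' hP

/-! ## Stub 1 — THE LEVER, reshaped (lead a2): très-ramifié SUPPLY (unprinted) + BCGP Thm 8.3.2 (named fact) -/

/-- **Stub 1a (`stub_tresRamifieSupply`) — the Diophantine core of THE LEVER (NOT in print).**  The planner's "first
reshape": the automorphic half of `TresRamifieSwitch` is vendored as the tree's named fact
`bcgp_residuallyA5b_modular_abelianSurface` (Stub 1b), and what remains is this purely ARITHMETIC-GEOMETRIC existence
statement with NO automorphic output (so Disproof §2's automorphic wall does not shield it): for a Yoshida-type
`ρ̄ : Γ_ℚ → GSp₄(𝔽₃)` — an `𝔽₃`-model of the pair (`IsModelOf`, `DetCond`), symplectic-`ε̄⁻¹`, ordinary-SHAPED at `3`, NOT peu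
ramifié at `3`, switchable at `2` — there is an abelian surface `B/ℚ` (`dim = 2`) with (a) `ρ̄_{B,3} ≅ ρ̄` as a contragredient
additive frame of `B[3](ℚ̄)`; (b) semistable-or-good reduction at `2` in Galois form (`(ρ_ℓ(τ) − 1)² = 0` for inertia `τ` at
`2`, all `ℓ ≠ 2`) with every framed dual of `V₂(B)` ordinary and `2`-distinguished at `2`
(`FramedGaloisRep.IsOrdinaryPDistinguishedAt`); (c′) `V₃(B)` ORDINARY-FILTERED at `3` (`IsOrdinaryFilteredAt` — in place of the
printed "good ordinary reduction at `3`", impossible here: `B[3]` très ramifié is not finite flat); (d) an additive frame of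
`B[2](ℚ̄)` with Galois image `S₅(b)` (`s5bMatrix`; every `w ∈ S₅` realised; complex conjugations act by double
transpositions).  VERBATIM the binder `h₁` of the tree's reduction
`bcgp_switch_exists_modular_abelianSurface_of_lemma942abcd_of_theorem832` (= the body of the named fact
`bcgp_switchingSurface_exists`, BCGP Lemma 9.4.2 (2)(a)–(d)), with the line's très-ramifié inputs and clause (c) ↦ (c′).
Intended proof (paper, card steps (a)–(d),(f)): rational `P(ρ̄)` [BCGP2021 §10.2]; semistable LOCAL ANCHOR at `3`
(`E₁ × E_q` / `E_q × E_{q'}`, Tate curves with `q` a square, odd theta characteristic from `−1 ∈ E_q[2]`, both symplectic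
form classes); OPENNESS at that point of bad reduction (Kisin local constancy of `B[35]` + Silverberg–Zarhin); weak
approximation off thin sets with the local conditions at `2, 3, ∞` (ibid. Lemma 9.4.1) + Hilbert irreducibility for (d) and
`End = ℤ`; (f) the ordinary filtration of `V₃` of a semistable surface with ordinary Raynaud abelian part (docstring of
`IsOrdinaryFilteredAt`).  Size L–XL; the one unprinted obligation of the line.
[cite: BoxerCalegariGeePilloni2025, Lemma 9.4.2, Lemma 9.4.1, Lemma 9.3.6, §9.2, Def. 9.1.2, Def. 1.8.8, §1.8.11, §8.1 (arXiv:2502.20645)]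
[cite: BoxerEtAl2021, §10.2 (P(ρ̄) rational)] [cite: Serre1987, §2.4, §2.8] [cite: Kisin1999LocalConstancy]
[cite: SilverbergZarhin1995, §6] [cite: Raynaud1994UnMotifs, §3–§4] [cite: GrothendieckSGA7IX, §3, 3.5; §7] -/
theorem stub_tresRamifieSupply :
    ∀ (k : Type) [Field k] [CharP k 3] [IsAlgClosed k] [TopologicalSpace k] [DiscreteTopology k]
    (σ σ' : FramedGaloisRep ℚ k 2) (ρb : FramedGaloisRep ℚ (ZMod 3) 4),
    IsModelOf ρb σ σ' → DetCond 3 σ σ' →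
    ρb.IsSymplecticWithMultiplierFun (fun g => (((epsBar 3 g)⁻¹ : (ZMod 3)ˣ) : ZMod 3)) →
    (∀ v : HeightOneSpectrum (𝓞 ℚ), ((3 : ℕ) : 𝓞 ℚ) ∈ v.asIdeal → IsOrdinaryShapedAt 3 v ρb) →
    ¬ (∀ v : HeightOneSpectrum (𝓞 ℚ), ((3 : ℕ) : 𝓞 ℚ) ∈ v.asIdeal → ModPGaloisRep.IsPeuRamifie (ρb.toLocal v)) →
    (∀ v : HeightOneSpectrum (𝓞 ℚ), ((2 : ℕ) : 𝓞 ℚ) ∈ v.asIdeal → IsSwitchableAtTwo 3 v ρb) →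
    ∃ B : AbelianVariety ℚ,
      B.dim = 2 ∧
      (∃ e₃ : B.geomTorsion (3 : ℕ) ≃+ (Fin 4 → ZMod 3),
        ∀ (g : Field.absoluteGaloisGroup ℚ) (P : B.geomTorsion (3 : ℕ)),
          e₃ (g • P) = ((ρb g⁻¹ : GL (Fin 4) (ZMod 3)) : Matrix (Fin 4) (Fin 4) (ZMod 3))ᵀ *ᵥ e₃ P) ∧
      (∀ (ℓ : ℕ) [Fact ℓ.Prime], ℓ ≠ 2 →
        ∀ v : HeightOneSpectrum (𝓞 ℚ), ((2 : ℕ) : 𝓞 ℚ) ∈ v.asIdeal →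
          ∀ τ ∈ absInertia (v.adicCompletion ℚ),
            (B.rationalTateRep ℓ (absGaloisRestrict ℚ (v.adicCompletion ℚ) τ) - 1) ^ 2 = 0) ∧
      (∀ (b₂ : Module.Basis (Fin 4) ℚ_[2] (B.rationalTateModule 2)) (r₂ : FramedGaloisRep ℚ (PadicAlgCl 2) 4),
        (∀ g : Field.absoluteGaloisGroup ℚ,
          (r₂ g).val =
            ((LinearMap.toMatrix b₂ b₂ (B.rationalTateRep 2 g⁻¹)).map (algebraMap ℚ_[2] (PadicAlgCl 2))).transpose) →
        ∀ v : HeightOneSpectrum (𝓞 ℚ), ((2 : ℕ) : 𝓞 ℚ) ∈ v.asIdeal → r₂.IsOrdinaryPDistinguishedAt v) ∧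
      (∀ v : HeightOneSpectrum (𝓞 ℚ), ((3 : ℕ) : 𝓞 ℚ) ∈ v.asIdeal → IsOrdinaryFilteredAt 3 B v) ∧
      (∃ e₂ : B.geomTorsion (2 : ℕ) ≃+ (Fin 4 → ZMod 2),
        (∀ g : Field.absoluteGaloisGroup ℚ, ∃ w : Equiv.Perm (Fin 5),
          ∀ P : B.geomTorsion (2 : ℕ), e₂ (g • P) = s5bMatrix w *ᵥ e₂ P) ∧
        (∀ w : Equiv.Perm (Fin 5), ∃ g : Field.absoluteGaloisGroup ℚ,
          ∀ P : B.geomTorsion (2 : ℕ), e₂ (g • P) = s5bMatrix w *ᵥ e₂ P) ∧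
        (∀ c : Field.absoluteGaloisGroup ℚ, IsComplexConjugation (algebraMap ℚ ℝ) c →
          ∃ w : Equiv.Perm (Fin 5), w.cycleType = {2, 2} ∧
            ∀ P : B.geomTorsion (2 : ℕ), e₂ (c • P) = s5bMatrix w *ᵥ e₂ P)) := by
  sorry

/-- **Stub 1b (`stub_factResiduallyA5bModular`) — BCGP 2025 Thm. 8.3.2 as the tree's NAMED FACT** (Literature
`bcgp_residuallyA5b_modular_abelianSurface`, `BcgpResiduallyA5bModular.lean`; `2`-adic ordinary modularity of residually
`A₅(b)` abelian surfaces in `GL₄` form; hypotheses at `2` and `∞` ONLY, so a surface semistable at `3` qualifies; no `_holds` —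
a theorem in print, XL, discharged only by the fact lane).  Kept separate from `stub_sectorFacts` so that obligation stays
byte-identical to the Burkhardt–Weddle line's.
[cite: BoxerCalegariGeePilloni2025, Thm. 8.3.2 with Remark 1.8.9, §1.8.10, Def. 1.8.12 (arXiv:2502.20645)] -/
theorem stub_factResiduallyA5bModular : bcgp_residuallyA5b_modular_abelianSurface := by
  sorry

/- Stub 1c `stub_tresRamifieSwitchOfSupply` (the lever from Stubs 1a–1b) is LANDED: `Theorems/…SemistableSector.lean` (p129342). -/

/-- **THE LEVER `TresRamifieSwitch` from the reshaped stubs 1a–1c** (sorry-free composition; formerly the registered stub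
`stub_tresRamifieSwitch` of the planner's skeleton). -/
theorem tresRamifieSwitch_of_stubs : TresRamifieSwitch :=
  stub_tresRamifieSwitchOfSupply stub_factResiduallyA5bModular stub_tresRamifieSupply

/-- **`SemistableSwitch` from the PRINTED switch, Serre–Tate, and Stub 1** (sorry-free).  Case split on "ρ̄ peu
ramifiée at 3": if yes, the Literature fact `bcgp_switch_exists_modular_abelianSurface` (its hypotheses are verbatim
ours plus `IsPeuRamifie`; `epsBar 3` is definitionally `modPCyclotomicCharacterZMod ℚ 3`) gives `B` with GOOD ordinary
reduction at `3`, and the Serre–Tate fact turns that into the ordinary filtration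
(`isOrdinaryFilteredAt_of_hasGoodOrdinaryReductionAt`); if no, Stub 1. -/
theorem semistableSwitch_of_facts (hBCGP : bcgp_switch_exists_modular_abelianSurface)
    (hST : ordinaryReduction_tateModule_filtration) (hTres : TresRamifieSwitch) : SemistableSwitch := by
  intro k _ _ _ _ _ σ σ' ρb hmodel hdet hsymp hshape htwo
  by_cases hpeu : ∀ v : HeightOneSpectrum (𝓞 ℚ), ((3 : ℕ) : 𝓞 ℚ) ∈ v.asIdeal →
      ModPGaloisRep.IsPeuRamifie (ρb.toLocal v)
  · -- the PRINTED case (peu ramifié = finite flat): BCGP Lemma 9.4.2 + Thm 8.3.2, then Serre–Tate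
    obtain ⟨B, hdim, hgood, hEnd, hH1⟩ := hBCGP ρb hsymp (fun v hv => ⟨hpeu v hv, hshape v hv⟩) htwo
    exact ⟨B, hdim, fun v hv => isOrdinaryFilteredAt_of_hasGoodOrdinaryReductionAt hST B v hv (hgood v hv), hEnd,
      fun b r hfr => hH1 b r hfr⟩
  · -- the NEW case (some très ramifié block): Stub 1
    exact hTres k σ σ' ρb hmodel hdet hsymp hshape hpeu htwo

/-! ## Greenberg `(0,0,1,1)` from the ordinary filtration (sorry-free: the landed proof, re-keyed to the filtration) -/

/- Stub 4 `stub_greenbergOfOrdinaryFiltration` is LANDED: `Theorems/…SemistableGreenberg.lean` (p128873). -/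

/-- `GreenbergOfOrdinaryFiltration` holds: the registered stub `stub_greenbergOfOrdinaryFiltration` (statement unfolded
there). [cite: Greenberg1991, §2] -/
theorem greenberg_of_ordinaryFiltration : GreenbergOfOrdinaryFiltration :=
  fun p _ B b ρ₀ hfr hdim v hv hfilt => stub_greenbergOfOrdinaryFiltration p B b ρ₀ hfr hdim v hv hfilt

/-! ## The SEMISTABLE SECTOR THEOREM modulo the named inputs (sorry-free) -/

/-- **The crux on the semistable sector, modulo its named inputs** (sorry-free re-glue of the landed LTWS
`stub_switchToModularSurface` + `stub_sectorModuloFacts`, with the FILTRATION output of the switch in place of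
Serre–Tate + good reduction).  Granted Finiteness I (route gate item `FaltingsFinitenessI`, stmt-Langlands-15084; Satz 3/4
over `ℚ` by the landed `faltings_tate_bijective_of_finitenessI` / `isSemisimpleRepresentation_rationalTateRep_of_finitenessI`),
the Weil pairing, `SemistableSwitch` and `GreenbergOfOrdinaryFiltration`, the crux holds at every datum with `p = 3` and
`SemistableSwitchable 3 k σ σ'`: `ρ₀ := H¹_ét(B_ℚ̄, ℚ̄₃)` framed (`framedH1`), symplectic-`ε⁻¹` (Weil), residual pair
`(σ, σ')` (congruence + model), irreducible (Faltings + `End = ℤ`), Greenberg `(0,0,1,1)` (filtration), residually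
distinguished (transfer from the H5-witness by `stub_charpolyCongruence` + `stub_distinguishedTransferLocal`), automorphic.
[cite: BoxerCalegariGeePilloni2025, Lemma 9.4.2, Thm. 8.3.2, Thm. 9.5.2 (arXiv:2502.20645)]
[cite: Faltings1983Endlichkeit, §5 Satz 3–4, §6 Satz 5–6] -/
theorem cruxAt_of_semistableSwitchable :
    FaltingsFinitenessI → weilPairing_rationalTateModule → SemistableSwitch → GreenbergOfOrdinaryFiltration →
    ∀ (p : ℕ) [Fact p.Prime], p ≠ 2 → ∀ (k : Type) [Field k] [CharP k p] [IsAlgClosed k]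
      [TopologicalSpace k] [DiscreteTopology k] (red : Valued.integer (PadicAlgCl p) →+* k)
      (σ σ' : FramedGaloisRep ℚ k 2),
      p = 3 → SemistableSwitchable p k σ σ' → CruxAt p k red σ σ' := by
  intro hFI hWeil hSwitch hGr p _ hp k _ _ _ _ _ red σ σ' hp3 hsw hA hA' hirr hirr' hdet hnc hw hcpt ι
  subst hp3
  obtain ⟨ρw, hShw⟩ := hw
  obtain ⟨ρb, hsymp, hmodel, hord, htwo⟩ := hsw
  -- the lever: a modular abelian surface with ordinary-filtered `V₃` and `ρ̄_{B,3}^{ss} ≅ ρb^{ss}`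
  obtain ⟨B, hdim, hfilt, hEnd, hH1⟩ := hSwitch k σ σ' ρb hmodel hdet hsymp hord htwo
  have hrank : Module.finrank ℚ_[3] (B.rationalTateModule 3) = 4 := by
    rw [B.finrank_rationalTateModule_eq_holds 3 (natCast_prime_ne_zero_rat 3), hdim]
  haveI : Module.Finite ℚ_[3] (B.rationalTateModule 3) :=
    Module.finite_of_finrank_pos (by rw [hrank]; norm_num)
  let b : Module.Basis (Fin 4) ℚ_[3] (B.rationalTateModule 3) :=
    Module.finBasisOfFinrankEq ℚ_[3] _ hrank
  -- `ρ₀ := H¹_ét(B_ℚ̄, ℚ̄₃)` framed in the dual basis of `b`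
  have hfr : TateFrame 3 B b (framedH1 3 B b) := tateFrame_framedH1 3 B b
  obtain ⟨hcong, hAut⟩ := hH1 b (framedH1 3 B b) hfr
  have hunr : ∀ᶠ v : HeightOneSpectrum (𝓞 ℚ) in Filter.cofinite, (framedH1 3 B b).IsUnramifiedAt v := by
    obtain ⟨ι'⟩ := PadicAlgCl.nonempty_ringEquiv_complex 3
    obtain ⟨π, -, hπ⟩ := hAut (isCompact_glFiniteIntegralLevel_holds 4 ℚ) ι'
    exact hπ.mono fun v ⟨a, _, h, _⟩ => h
  -- the dictionary: symplectic (Weil), residual pair (congruence), irreducible (Faltings via Finiteness I),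
  -- Greenberg (Stub 2 on the filtration), residually distinguished (transfer from the H5-witness)
  have hsymp₀ := isSymplectic_framedH1 3 hWeil B b
  have hpair : (framedH1 3 B b).HasResidualPair red σ σ' :=
    hasResidualPair_of_congruence red hmodel hcong hunr
  have hirr₀ : (framedH1 3 B b).toGaloisRep.IsIrreducible :=
    stub_tateModuleIrreducible_of 3 B (faltings_tate_bijective_of_finitenessI hFI 3 B)
      (isSemisimpleRepresentation_rationalTateRep_of_finitenessI hFI 3 B) b (framedH1 3 B b) hfr hEnd
  have hGr₀ : ∀ v : HeightOneSpectrum (𝓞 ℚ), ((3 : ℕ) : 𝓞 ℚ) ∈ v.asIdeal →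
      (framedH1 3 B b).IsGreenbergOrdinaryOfShapeAt v ![0, 0, 1, 1] :=
    fun v hv => hGr 3 B b (framedH1 3 B b) hfr hdim v hv (hfilt v hv)
  refine ⟨framedH1 3 B b, hirr₀, ⟨hsymp₀, fun v hv => ⟨hGr₀ v hv, ?_⟩, hpair⟩, hAut hcpt ι⟩
  exact stub_distinguishedTransferLocal 3 hp k red ρw (framedH1 3 B b) v hv
    (stub_charpolyCongruence 3 k red σ σ' ρw (framedH1 3 B b) hShw.2.2 hpair) (hShw.2.1 v hv).2 (hGr₀ v hv)

/-! ## Stub 2 — the PUBLISHED FACTS of the sector, bundled (not a worker task; IDENTICAL to BW's `stub_sectorFacts`) -/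

/-- **Stub 2 (`stub_sectorFacts`; theorems in print, ONE registered obligation — byte-identical to the registered
`…BurkhardtWeddleTwoThreeAnchor.stub_sectorFacts` of the BW skeleton, so the two lines share it).**  (F1) FALTINGS —
through the route's named-fact gate item `FaltingsFinitenessI` (stmt-Langlands-15084: Finiteness I over `ℚ`, Faltings
1983 §6 Satz 5–6; Satz 3/4 follow in-tree); (F2) SERRE–TATE — the ordinary filtration of `V_p B` for GOOD ordinary
reduction (Literature `ordinaryReduction_tateModule_filtration`, p86833; used only in the peu-ramifié case of
`semistableSwitch_of_facts`); (F3) BCGP2025 — the PRINTED `2`–`3` switch (Literature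
`bcgp_switch_exists_modular_abelianSurface`, p92170; the peu-ramifié case); (F4) WEIL — `V_p B` symplectic with
multiplier `χ_p` (Literature `weilPairing_rationalTateModule`, p86824).  Discharged exactly by `_holds` proofs / the gate
item closing; until then the line is CLOSED on its sector MODULO them and Stub 1.
[cite: Faltings1983Endlichkeit, §5 Satz 3–4, §6 Satz 5–6; SerreTate1968GoodReduction, §1; Greenberg1991, §2;
BoxerCalegariGeePilloni2025, Lemma 9.4.2, Thm. 8.3.2, Thm. 9.5.2; Milne1986AbelianVarieties, §16] -/
theorem stub_sectorFacts :
    FaltingsFinitenessI ∧ ordinaryReduction_tateModule_filtration ∧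
      bcgp_switch_exists_modular_abelianSurface ∧ weilPairing_rationalTateModule := by
  sorry

/-! ## Stub 3 — the HONEST REMAINDER: the crux off the semistable sector (open; not claimed) -/

/-- **Stub 3 (`stub_offSemistableSector`, OPEN — the remainder this line does NOT attack).**  For data outside
`SemistableSector p k σ σ'` — every odd `p ≠ 3` (regime R4 of Disproof §5: `A₂(p)`-twists of general type, no
Diophantine supply — except the `p = 5` bilevel window of the sibling round-2 card `bilevel-one-five-anchor`; the settled
functorial sub-regimes R1/D1 live here too), and at `p = 3` the pairs whose `charpoly σ · charpoly σ'` is not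
`𝔽₃`-rational, or which are ramified at `2`, or have `Frob₂ ∈ 4C ∪ 12C` (these 2-adic clauses are GENUINELY needed:
ibid. Thm 9.5.2 / Lemma 9.4.2 (1)) — the crux `CruxAt p k red σ σ'` as filed.  STRICTLY WEAKER than BW's registered
`stub_offSector` (`semistableSector_of_bwSector`: the très ramifié pairs have moved into the sector) but it still carries
the crux's generic difficulty: expected dimension `-1` independently of the level (Disproof §6), no engine in print for
generic `p ≥ 7`; a RIGID PAIR (Disproof §3.4) off the sector refutes it and the crux with it.  Hand-off: `promote-stub` /
the planners' sector-children itemisation (A₁ = BW, A₂ = this line's sector, A₃ = bilevel p = 5, B = remainder) or the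
`Irr'` restatement (Disproof `closes_irr'`).  Size: open (XL⁺).
[cite: BoxerCalegariGeePilloni2025, Remark 9.4.4, Thm. 9.5.2; HulekSankaran2002; Sorensen2006; LemmaOchiai2023;
HsiehPalvannan2025; DeoPalvannan2026 (arXiv:2602.20737)] -/
theorem stub_offSemistableSector :
    ∀ (p : ℕ) [Fact p.Prime], p ≠ 2 → ∀ (k : Type) [Field k] [CharP k p] [IsAlgClosed k]
      [TopologicalSpace k] [DiscreteTopology k] (red : Valued.integer (PadicAlgCl p) →+* k)
      (σ σ' : FramedGaloisRep ℚ k 2),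
      ¬ SemistableSector p k σ σ' → CruxAt p k red σ σ' := by
  sorry

/-! ## Stub 5 — the SEMISTABLE SECTOR THEOREM modulo the lever: LANDED (`Theorems/…SemistableSector.lean`, p129342) -/

/-! ## Glue (sorry-free): the crux from the registered stubs -/

/-- **`StableYoshidaCongruence` from the line `semistable-three-adic-anchor`.**  Regime split on the semistable sector.
IN the sector: Stub 5 `stub_semistableSectorModuloLever` (the sector theorem, proved in Theorems/…SemistableSector.lean)
fed with Stub 2 (the four printed facts) and Stub 1 (the très ramifié switch, THE LEVER); equivalently the in-file
sorry-free chain `semistableSwitchable_of_sector` → `semistableSwitch_of_facts` → `cruxAt_of_semistableSwitchable` with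
`greenberg_of_ordinaryFiltration` (= Stub 4 `stub_greenbergOfOrdinaryFiltration`, proved in
Theorems/…SemistableGreenberg.lean).  OFF the sector: Stub 3.  Open after the two landings: Stub 1 (the lever, unprinted),
Stub 2 (theorems in print), Stub 3 (the open remainder).  The type of this theorem is literally the route decl. -/
theorem StableYoshidaCongruence_of : StableYoshidaCongruence := by
  refine crux_iff.mpr fun p _ hp k _ _ _ _ _ red σ σ' => ?_
  by_cases hsec : SemistableSector p k σ σ'
  · obtain ⟨hFI, hST, hBCGP, hWeil⟩ := stub_sectorFacts
    exact stub_semistableSectorModuloLever hFI hST hBCGP hWeil tresRamifieSwitch_of_stubs p hp k red σ σ' hsec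
  · exact stub_offSemistableSector p hp k red σ σ' hsec

/-- The in-file chain agrees with Stub 5 (sanity: the sector theorem assembled from the sorry-free pieces of this
skeleton, exactly as before the reshape). -/
theorem cruxAt_of_semistableSector_inFile (hFI : FaltingsFinitenessI) (hST : ordinaryReduction_tateModule_filtration)
    (hBCGP : bcgp_switch_exists_modular_abelianSurface) (hWeil : weilPairing_rationalTateModule)
    (p : ℕ) [Fact p.Prime] (hp : p ≠ 2) (k : Type) [Field k] [CharP k p] [IsAlgClosed k]
    [TopologicalSpace k] [DiscreteTopology k] (red : Valued.integer (PadicAlgCl p) →+* k)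
    (σ σ' : FramedGaloisRep ℚ k 2) (hsec : SemistableSector p k σ σ') : CruxAt p k red σ σ' := by
  obtain ⟨hp3, hrat, htwo⟩ := hsec
  intro hA hA' hirr hirr' hdet hnc hw
  exact cruxAt_of_semistableSwitchable hFI hWeil (semistableSwitch_of_facts hBCGP hST tresRamifieSwitch_of_stubs)
    greenberg_of_ordinaryFiltration p hp k red σ σ' hp3
    (semistableSwitchable_of_sector p hp k red σ σ' hrat htwo hirr hirr' hdet hnc hw)
    hA hA' hirr hirr' hdet hnc hw

end Summit.Langlands.Langlands.Cruxes.StableYoshidaCongruence.SemistableThreeAdicAnchor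

end
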